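import Mathlib
import Literature.NumberTheory.EllipticCurves.Smith2016.CongruentNumberGenusDeterminantRowFiveBForest
import Literature.NumberTheory.EllipticCurves.Smith2016.CongruentNumberGenusDecompositionPointed
import Literature.NumberTheory.EllipticCurves.Smith2016.CongruentNumberGenusSumSelmerEightFive

/-!
# Smith 2016, Theorem 2.2 row 5(b) for every `k`: `Σ₂'(n) − Σ₁(n) = |M₁ bordered by (0; y)|`, and `Σ₂'(n)` odd `⟹ #Sel₂(E⁽ⁿ⁾) = 8` (`n ≡ 5 (8)`)

A. Smith, *The congruent numbers have positive natural density*, arXiv:1603.08479 [Smith2016CongruentDensity],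
Table 2 row 5(b) (source `cnc.tex` l. 88–93): for `n ≡ 5 (mod 8)`,
`ℒ_{5b}(n) = Σ_{d₀d₁ | n, d₀ ≡ 7 (8), d₁ ≡ 3 (8)} g(d₀)g(d₁)ℒ(n/d₀d₁)`, `M_{5b} = [[A + Aᵀ, Aᵀ, 0],[A, D_z, y],[0, yᵀ, 0]]`;
Thm. 2.2: `ℒ_{5b}(n) = det M_{5b}`.  By Thm. 2.1 of the source (= [TianYuanZhang2017] Thm. 1.2 as printed) the two
row-5 expressions are Tian–Yuan–Zhang's genus sums: for `n ≡ 5 (8)`, `Σ₁(n) = ℒ_{5a}(n)` (`RowFiveA`) and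
`Σ₂'(n) = Σ_{d₀ ≡ 5,6,7, d₁ ≡ 1,2,3, dᵢ ≡ 1} ∏ g = ℒ_{5a}(n) + ℒ_{5b}(n)` (main block `d₀ ≡ 5` with all other blocks
`≡ 1`, or main block `d₀ ≡ 7` with one companion `d₁ ≡ 3 (8)`; the tree's brackets `B₅`, `B₇` of
`TianYuanZhang2017.W2`).

What is proved (every number of prime factors; no named fact):
* `genusSum₂'_eq_genusSum₁_add_bSeven_of_five`, `natCast_bSeven_eq_sum_powerset_five` — the genus side:
  `Σ₂'(n) = Σ₁(n) + B₇(n)` and `B₇(n) ≡ Σ_{S : d_S ≡ 3 (8)} g(d_S) Σ_{C : d_C ≡ 7 (8)} g(d_C) ℒ(d_{[k]∖S∖C})`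
  (two-pointed decomposition sums, `CongruentNumberGenusDecompositionPointed`);
* `genusSum₂'_eq_genusSum₁_add_border_adjugate_fiveB` — **row 5(b)**: for `n = p₁⋯p_k ≡ 5 (mod 8)`,
  `Σ₂'(n) ≡ Σ₁(n) + bᵀ adj(M₁) b (mod 2)`, `b = (0; t)`, `t = ((−1/pᵢ)₊)`, `M₁ = [[A + Aᵀ, Aᵀ],[A, D_z]]` — the
  bordered determinant `det M_{5b} = bᵀ adj(M₁) b` over `𝔽₂`; with row 5(a) (`RowFiveA`):
  `genusSum₂'_eq_border_adjugate_fiveA_add_fiveB` — `Σ₂'(n) ≡ det M_{5a} + det M_{5b}`;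
* `card_selmerGroup_two_eq_eight_of_odd_genusSum₂'_five` — **for `n ≡ 5 (mod 8)` square-free with `Σ₂'(n)` odd,
  `#Sel⁽²⁾(E⁽ⁿ⁾/ℚ) = 8`** (Smith's Prop. 3.2 for `x = 5b`: a nonzero bordered determinant forces `adj(M₁) ≠ 0`,
  `rank M₁ ≥ 2k − 1`, Monsky's `s(n) ≤ 1`, and `s(n)` is odd); with `RowFiveA`'s `Σ₁`-version this is the full
  `2`-Selmer companion of Tian–Yuan–Zhang's Thm. 1.2 on `n ≡ 5 (8)` ("`2^{−ρ}𝓛(n)` is even only if `Σ₁ ≡ Σ₂' ≡ 0`"):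
  `Σ₁(n)` odd or `Σ₂'(n)` odd `⟹ #Sel₂(E⁽ⁿ⁾) = 8` (`card_selmerGroup_two_eq_eight_of_odd_genusSum_five`), no `L`-function.
-/

namespace Literature.NumberTheory.EllipticCurves.Smith2016

open _root_.Matrix Finset Literature.LinearAlgebra.Matrix Literature.Combinatorics.Enumerative
open Literature.NumberTheory.EllipticCurves.HeathBrown1994
open Literature.NumberTheory.EllipticCurves.TianYuanZhang2017
open Literature.NumberTheory.EllipticCurves.TianYuanZhang2017.W2
open Literature.NumberTheory.EllipticCurves.MonskySelmerParity

variable {k : ℕ} (p : Fin k → ℕ)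

section GenusSide

open scoped Classical in
/-- **`Σ₂'(n) = Σ₁(n) + B₇(n)` for `n ≡ 5 (mod 8)`**: the main blocks `≡ 5` of `Σ₂'` are exactly the decompositions
of `Σ₁` (`W2.genusSum₁_eq_bFivePlain`), there is no even block, and a main block `≡ 5` has no companion `≡ 3`.
[cite: TianYuanZhang2017, Thm. 1.2 as printed (n ≡ 5 (8)) and proof of Thm. 3.5 (2) (p0020 L123–L165)] -/
theorem genusSum₂'_eq_genusSum₁_add_bSeven_of_five {n : ℕ} (h5 : n % 8 = 5) :
    genusSum₂' n gK = genusSum₁ n gK + bSeven n := by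
  rw [genusSum₂'_eq_brackets, bFiveI_eq_zero_of_five h5, bSix_eq_zero_of_odd (Nat.odd_iff.mpr (by omega)),
    genusSum₁_eq_bFivePlain h5, add_zero, add_zero]

open scoped Classical in
/-- The row-5(b) pointed weight: for `n ≡ 5 (8)` and `d₀ ∈ D ∈ decompositions n`, `d₀` is a main block `≡ 7 (8)` iff
`d₀ ≡ 7 (8)` with exactly one companion block `e ≡ 3 (8)` and all others `≡ 1 (8)`; the bracket summand is then
`ν₇(d₀) · Σ_{e ≠ d₀} ν₃(e) ∏_{d ≠ d₀,e} [d ≡ 1 (8)] g(d)` (`ν_r(d) = [d ≡ r (8)] g(d)`).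
[cite: TianYuanZhang2017, Thm. 1.2 and proof of Thm. 3.5 (2) (p0020 L123–L165: main block d₀ ≡ 7, n ≡ 5)] -/
theorem natCast_bSeven_summand_eq_five {n : ℕ} (h5 : n % 8 = 5) {D : Finset ℕ} (hD : D ∈ decompositions n)
    {d₀ : ℕ} (hd₀ : d₀ ∈ D) :
    ((if MainBlock D d₀ ∧ QSeven D d₀ then ∏ d ∈ D, gK d else 0 : ℕ) : ZMod 2) =
      (if d₀ % 8 = 7 then ((gK d₀ : ℕ) : ZMod 2) else 0) *
        ∑ e ∈ D.erase d₀, (if e % 8 = 3 then ((gK e : ℕ) : ZMod 2) else 0) *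
          ∏ d ∈ (D.erase d₀).erase e, (if d % 8 = 1 then ((gK d : ℕ) : ZMod 2) else 0) := by
  by_cases hP : MainBlock D d₀ ∧ QSeven D d₀
  · have hM := hP.1
    have hQ7 : d₀ % 8 = 7 := hP.2
    rw [if_pos hP, if_pos hQ7, Nat.cast_prod, ← mul_prod_erase D (fun d => ((gK d : ℕ) : ZMod 2)) hd₀]
    congr 1
    rcases mainBlock_cases hD hd₀ hM with ⟨h, -⟩ | ⟨e, heD, hne, he23, hne8, hrest⟩
    · omega
    · have he3 : e % 8 = 3 := by
        rw [hQ7] at hne8; rcases he23 with h | h <;> rw [h] at hne8 <;> omega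
      have he' : e ∈ D.erase d₀ := mem_erase.mpr ⟨hne, heD⟩
      rw [← mul_prod_erase (D.erase d₀) (fun d => ((gK d : ℕ) : ZMod 2)) he',
        sum_eq_single_of_mem e he' (fun e' he'' hne' => by
          have h1 := hrest e' (mem_of_mem_erase he'') (ne_of_mem_erase he'') hne'
          rw [if_neg (by omega), zero_mul]), if_pos he3]
      congr 1
      refine prod_congr rfl fun d hd => ?_
      rw [if_pos (hrest d (mem_of_mem_erase (mem_of_mem_erase hd)) (ne_of_mem_erase (mem_of_mem_erase hd))
        (ne_of_mem_erase hd))]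
  · rw [if_neg hP, Nat.cast_zero]
    by_cases h7 : d₀ % 8 = 7
    · rw [if_pos h7]
      -- every summand vanishes, else `d₀` would be a main block `≡ 7`
      symm
      rw [mul_eq_zero]
      right
      refine sum_eq_zero fun e he => ?_
      by_cases he3 : e % 8 = 3
      · rw [if_pos he3]
        by_contra hne
        have hall : ∀ d ∈ (D.erase d₀).erase e, d % 8 = 1 := by
          intro d hd
          by_contra hd1
          apply hne
          rw [prod_eq_zero hd (by rw [if_neg hd1]), mul_zero]
        apply hP
        refine ⟨⟨Or.inr (Or.inr h7), fun d hd hdd => ?_, ?_⟩, h7⟩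
        · by_cases hde : d = e
          · rw [hde]; exact Or.inr (Or.inr he3)
          · exact Or.inl (hall d (mem_erase.mpr ⟨hde, mem_erase.mpr ⟨hdd, hd⟩⟩))
        · rw [Finset.card_le_one]
          intro a ha b hb
          rw [mem_filter] at ha hb
          have hae : a = e := by
            by_contra h; exact ha.2 (hall a (mem_erase.mpr ⟨h, ha.1⟩))
          have hbe : b = e := by
            by_contra h; exact hb.2 (hall b (mem_erase.mpr ⟨h, hb.1⟩))
          rw [hae, hbe]
      · rw [if_neg he3, zero_mul]
    · rw [if_neg h7, zero_mul]

open scoped Classical in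
/-- **`B₇` as a two-pointed product weight** for `n ≡ 5 (mod 8)`:
`B₇(n) ≡ Σ_D Σ_{d₀ ∈ D} Σ_{e ∈ D∖d₀} ν₇(d₀) · ν₃(e) · ∏_{d ∈ D∖{d₀,e}} [d ≡ 1 (8)] g(d) (mod 2)`.
[cite: TianYuanZhang2017, Thm. 1.2 and proof of Thm. 3.5 (2) (p0020 L123–L165)] [cite: Smith2016CongruentDensity, Table 2 row 5(b) (ℒ_{5b})] -/
theorem natCast_bSeven_eq_sum_twoPointed_five {n : ℕ} (h5 : n % 8 = 5) :
    ((bSeven n : ℕ) : ZMod 2) = ∑ D ∈ decompositions n, ∑ d₀ ∈ D, ∑ e ∈ D.erase d₀,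
      (if d₀ % 8 = 7 then ((gK d₀ : ℕ) : ZMod 2) else 0) *
        ((if e % 8 = 3 then ((gK e : ℕ) : ZMod 2) else 0) *
          ∏ d ∈ (D.erase d₀).erase e, (if d % 8 = 1 then ((gK d : ℕ) : ZMod 2) else 0)) := by
  rw [bSeven, coef, Nat.cast_sum]
  refine sum_congr rfl fun D hD => ?_
  rw [sum_filter, Nat.cast_sum]
  refine sum_congr rfl fun d₀ hd₀ => ?_
  rw [← mul_sum, ← natCast_bSeven_summand_eq_five h5 hD hd₀]
  by_cases hM : MainBlock D d₀
  · rw [if_pos hM]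
    by_cases hQ : QSeven D d₀
    · rw [if_pos hQ, if_pos ⟨hM, hQ⟩]
    · rw [if_neg hQ, if_neg (fun h => hQ h.2)]
  · rw [if_neg hM, if_neg (fun h => hM h.1)]

/-- **`B₇` over index blocks** for `n = p₁⋯p_k ≡ 5 (mod 8)`:
`B₇(n) ≡ Σ_{S ⊆ [k], d_S ≡ 3 (8)} g(d_S) · Σ_{C ⊆ [k]∖S, d_C ≡ 7 (8)} g(d_C) · ℒ(d_{[k]∖S∖C}) (mod 2)` — Smith's `ℒ_{5b}(n)`.
[cite: Smith2016CongruentDensity, Thm. 2.2 / Table 2 row 5(b) (source cnc.tex l. 88–93)] [cite: TianYuanZhang2017, Thm. 1.2 (n ≡ 5 (8))] -/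
theorem natCast_bSeven_eq_sum_powerset_five (hp : ∀ i, (p i).Prime) (hinj : Function.Injective p)
    (h8 : (∏ i, p i) % 8 = 5) :
    ((bSeven (∏ i, p i) : ℕ) : ZMod 2) =
      ∑ S ∈ (univ : Finset (Fin k)).powerset,
        (if (∏ i ∈ S, p i) % 8 = 3 then ((gK (∏ i ∈ S, p i) : ℕ) : ZMod 2) else 0) *
        ∑ C ∈ (univ \ S).powerset,
          (if (∏ i ∈ C, p i) % 8 = 7 then ((gK (∏ i ∈ C, p i) : ℕ) : ZMod 2) else 0) *
          ∑ D ∈ decompositions (∏ i ∈ (univ \ S) \ C, p i), ∏ d ∈ D,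
            (if d % 8 = 1 then ((gK d : ℕ) : ZMod 2) else 0) := by
  rw [natCast_bSeven_eq_sum_twoPointed_five h8,
    show (∏ i, p i) = ∏ i ∈ (univ : Finset (Fin k)), p i from rfl,
    sum_decompositions_twoPointed_prod_eq p hp hinj _ _ _ univ]
  -- drop the nonemptiness filters (the weights vanish on the empty block, `d_∅ = 1 ≡ 1 (8)`)
  rw [sum_filter_of_ne (fun B _ hB => by
    by_contra h
    rw [not_nonempty_iff_eq_empty] at h
    rw [h, prod_empty, if_neg (by norm_num), zero_mul] at hB
    exact hB rfl)]
  rw [sum_congr rfl fun B _ => by rw [sum_filter_of_ne (fun B' _ hB' => by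
    by_contra h
    rw [not_nonempty_iff_eq_empty] at h
    rw [h, prod_empty, if_neg (by norm_num), zero_mul] at hB'
    exact hB' rfl)]]
  -- swap the two disjoint blocks (the `≡ 7` block is outer on the left, inner on the right)
  simp_rw [mul_sum]
  rw [sum_powerset_sum_powerset_sdiff_comm]
  refine sum_congr rfl fun S _ => sum_congr rfl fun C _ => ?_
  rw [sdiff_sdiff_comm]
  ring

end GenusSide

section RowFiveB

/-- **Smith 2016, Theorem 2.2 row 5(b) — for every `k`**: for `n = p₁⋯p_k ≡ 5 (mod 8)` a product of distinct odd
primes, `Σ₂'(n) ≡ Σ₁(n) + bᵀ adj(M₁) b (mod 2)` with `b = (0; (−1/pᵢ)₊)` and `M₁ = [[A + Aᵀ, Aᵀ],[A, D_z]]`, i.e.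
`ℒ_{5b}(n) = Σ₂'(n) − Σ₁(n)` is the determinant of Smith's bordered matrix `M_{5b} = [[M₁, b],[bᵀ, 0]]`.
[cite: Smith2016CongruentDensity, Thm. 2.2 row 5(b) / Table 2 (source cnc.tex l. 88–93) and §2.2 (cnc2.tex l. 44–62)] [cite: TianYuanZhang2017, Thm. 1.2 as printed (n ≡ 5 (8): the sums Σ₁ and Σ₂')] -/
theorem genusSum₂'_eq_genusSum₁_add_border_adjugate_fiveB (hp : ∀ i, (p i).Prime) (hodd : ∀ i, Odd (p i))
    (hinj : Function.Injective p) (h8 : (∏ i, p i) % 8 = 5) :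
    ((genusSum₂' (∏ i, p i) (fun d => genusClassNumber (GenusField d)) : ℕ) : ZMod 2) =
      ((genusSum₁ (∏ i, p i) (fun d => genusClassNumber (GenusField d)) : ℕ) : ZMod 2) +
      Sum.elim (0 : Fin k → ZMod 2) (fun i => addLegendreSym (-1) (p i)) ⬝ᵥ
        ((fromBlocks (legendreMatrix p + (legendreMatrix p)ᵀ) (legendreMatrix p)ᵀ (legendreMatrix p)
            (legendreDiagonal p 2)).adjugate *ᵥ
          Sum.elim (0 : Fin k → ZMod 2) (fun i => addLegendreSym (-1) (p i))) := by
  rw [show (fun d => genusClassNumber (GenusField d)) = gK from rfl, genusSum₂'_eq_genusSum₁_add_bSeven_of_five h8,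
    Nat.cast_add, natCast_bSeven_eq_sum_powerset_five p hp hinj h8,
    border_adjugate_fiveB_eq_sum_genusWeight p hp hodd hinj h8]
  rfl

/-- **Rows 5(a) and 5(b) together**: for `n = p₁⋯p_k ≡ 5 (mod 8)`,
`Σ₂'(n) ≡ uᵀ adj(M₁) u + bᵀ adj(M₁) b (mod 2)` with `u = ((−1/pᵢ)₊ + (2/pᵢ)₊; 0)`, `b = (0; (−1/pᵢ)₊)` —
`Σ₂'(n) = ℒ_{5a}(n) + ℒ_{5b}(n) = det M_{5a} + det M_{5b}`.
[cite: Smith2016CongruentDensity, Thm. 2.2 rows 5(a), 5(b)] [cite: TianYuanZhang2017, Thm. 1.2 as printed (n ≡ 5 (8))] -/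
theorem genusSum₂'_eq_border_adjugate_fiveA_add_fiveB (hp : ∀ i, (p i).Prime) (hodd : ∀ i, Odd (p i))
    (hinj : Function.Injective p) (h8 : (∏ i, p i) % 8 = 5) :
    ((genusSum₂' (∏ i, p i) (fun d => genusClassNumber (GenusField d)) : ℕ) : ZMod 2) =
      Sum.elim (fun i => addLegendreSym (-1) (p i) + addLegendreSym 2 (p i)) (0 : Fin k → ZMod 2) ⬝ᵥ
        ((fromBlocks (legendreMatrix p + (legendreMatrix p)ᵀ) (legendreMatrix p)ᵀ (legendreMatrix p)
            (legendreDiagonal p 2)).adjugate *ᵥ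
          Sum.elim (fun i => addLegendreSym (-1) (p i) + addLegendreSym 2 (p i)) (0 : Fin k → ZMod 2)) +
      Sum.elim (0 : Fin k → ZMod 2) (fun i => addLegendreSym (-1) (p i)) ⬝ᵥ
        ((fromBlocks (legendreMatrix p + (legendreMatrix p)ᵀ) (legendreMatrix p)ᵀ (legendreMatrix p)
            (legendreDiagonal p 2)).adjugate *ᵥ
          Sum.elim (0 : Fin k → ZMod 2) (fun i => addLegendreSym (-1) (p i))) := by
  rw [genusSum₂'_eq_genusSum₁_add_border_adjugate_fiveB p hp hodd hinj h8,
    genusSum₁_eq_border_adjugate_five p hp hodd hinj h8]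

end RowFiveB

section SelmerEight

/-- **A nonzero cofactor of `M₁` forces `#Sel⁽²⁾(E⁽ⁿ⁾/ℚ) = 8`** for `n = p₁⋯p_k ≡ 5 (mod 8)`: `rank M₁ ≥ 2k − 1`,
so Monsky's `s(n) = 2k − rank M₁ ≤ 1`, and `s(n)` is odd.
[cite: Smith2016CongruentDensity, Prop. 3.2 (chunk p0011 L58–L66: "If n ≡ 5 (8), then the minimal possible corank of M₁ is one")] [cite: HeathBrown1994SelmerCongruentII, Appendix (Monsky), Theorem (typescript p. 38 L5–L7) and p. 39 L27–L33] -/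
theorem card_selmerGroup_two_eq_eight_of_adjugate_ne_zero_five (hp : ∀ i, (p i).Prime)
    (hodd : ∀ i, Odd (p i)) (hinj : Function.Injective p) (h8 : (∏ i, p i) % 8 = 5) {i j : Fin k ⊕ Fin k}
    (hij : (fromBlocks (legendreMatrix p + (legendreMatrix p)ᵀ) (legendreMatrix p)ᵀ (legendreMatrix p)
      (legendreDiagonal p 2)).adjugate i j ≠ 0) :
    Nat.card ((congruentNumberCurve (∏ i, p i)).selmerGroup 2) = 8 := by
  have h4 : (∏ i, p i) % 4 = 1 := by omega
  have hp2 := ne_two_of_odd p hodd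
  have hrank := card_le_rank_add_one_of_adjugate_ne_zero _ hij
  rw [Fintype.card_sum, Fintype.card_fin] at hrank
  have hs := monskySelmerRankOdd_eq_sub_rank_smithMatrixOne p hp hodd hinj h4
  have hsodd : Odd (monskySelmerRankOdd p) :=
    (odd_monskySelmerRankOdd_iff p hp hp2 hinj).mpr (Or.inl h8)
  have hs1 : monskySelmerRankOdd p = 1 := by
    have hle : monskySelmerRankOdd p ≤ 1 := by rw [hs]; omega
    rcases Nat.le_one_iff_eq_zero_or_eq_one.mp hle with h0 | h1
    · rw [h0] at hsodd; exact absurd hsodd (by decide)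
    · exact h1
  rw [monsky_card_selmerGroup_two_odd_holds k p hp hodd hinj, hs1]
  norm_num

/-- **`Σ₂'(n)` odd `⟹ #Sel⁽²⁾(E⁽ⁿ⁾/ℚ) = 8` for `n = p₁⋯p_k ≡ 5 (mod 8)`** (every `k`): `Σ₂' ≡ uᵀadj(M₁)u + bᵀadj(M₁)b`
is `1`, so `adj(M₁) ≠ 0`. [cite: Smith2016CongruentDensity, Prop. 3.2 with Thm. 2.2 rows 5(a), 5(b)] [cite: TianYuanZhang2017, Thm. 1.2 as printed (n ≡ 5 (8))] -/
theorem card_selmerGroup_two_eq_eight_of_odd_genusSum₂'_five (hp : ∀ i, (p i).Prime)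
    (hodd : ∀ i, Odd (p i)) (hinj : Function.Injective p) (h8 : (∏ i, p i) % 8 = 5)
    (hodd2 : Odd (genusSum₂' (∏ i, p i) fun d => genusClassNumber (GenusField d))) :
    Nat.card ((congruentNumberCurve (∏ i, p i)).selmerGroup 2) = 8 := by
  set M₁ := fromBlocks (legendreMatrix p + (legendreMatrix p)ᵀ) (legendreMatrix p)ᵀ (legendreMatrix p)
    (legendreDiagonal p 2) with hM₁
  have hq := genusSum₂'_eq_border_adjugate_fiveA_add_fiveB p hp hodd hinj h8
  rw [(ZMod.natCast_eq_one_iff_odd).mpr hodd2] at hq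
  have hex : ∃ i j, M₁.adjugate i j ≠ 0 := by
    by_contra hall
    push Not at hall
    have h0 : M₁.adjugate = 0 := by ext i j; exact hall i j
    rw [← hM₁, h0, zero_mulVec, zero_mulVec, dotProduct_zero, dotProduct_zero, add_zero] at hq
    exact one_ne_zero hq
  obtain ⟨i, j, hij⟩ := hex
  exact card_selmerGroup_two_eq_eight_of_adjugate_ne_zero_five p hp hodd hinj h8 hij

/-- **The `2`-Selmer companion of Tian–Yuan–Zhang's Thm. 1.2 on `n ≡ 5 (mod 8)`, for every `k`**:
if `Σ₁(n)` or `Σ₂'(n)` is odd then `#Sel⁽²⁾(E⁽ⁿ⁾/ℚ) = 8` (`n = p₁⋯p_k ≡ 5 (mod 8)`).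
[cite: TianYuanZhang2017, Thm. 1.2 as printed ("2^{−ρ(n)}𝓛(n) is even only if Σ₁ ≡ Σ₂' ≡ 0 (mod 2)")] [cite: Smith2016CongruentDensity, Prop. 3.2 with Thm. 2.2 rows 5(a), 5(b)] -/
theorem card_selmerGroup_two_eq_eight_of_odd_genusSum_five (hp : ∀ i, (p i).Prime)
    (hodd : ∀ i, Odd (p i)) (hinj : Function.Injective p) (h8 : (∏ i, p i) % 8 = 5)
    (hor : Odd (genusSum₁ (∏ i, p i) fun d => genusClassNumber (GenusField d)) ∨
      Odd (genusSum₂' (∏ i, p i) fun d => genusClassNumber (GenusField d))) :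
    Nat.card ((congruentNumberCurve (∏ i, p i)).selmerGroup 2) = 8 := by
  rcases hor with h1 | h2
  · exact card_selmerGroup_two_eq_eight_of_odd_genusSum₁_five p hp hodd hinj h8 h1
  · exact card_selmerGroup_two_eq_eight_of_odd_genusSum₂'_five p hp hodd hinj h8 h2

/-- **For every square-free `N ≡ 5 (mod 8)`: `Σ₁(N)` odd or `Σ₂'(N)` odd `⟹ #Sel⁽²⁾(E_N/ℚ) = 8`** (enumeration-free).
[cite: TianYuanZhang2017, Thm. 1.2 as printed (n ≡ 5 (8))] [cite: Smith2016CongruentDensity, Prop. 3.2 with Thm. 2.2 rows 5(a), 5(b)] -/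
theorem card_selmerGroup_two_eq_eight_of_odd_genusSum_five' {N : ℕ} (hN : Squarefree N) (h8 : N % 8 = 5)
    (hor : Odd (genusSum₁ N fun d => genusClassNumber (GenusField d)) ∨
      Odd (genusSum₂' N fun d => genusClassNumber (GenusField d))) :
    Nat.card ((congruentNumberCurve N).selmerGroup 2) = 8 := by
  obtain ⟨k, p, hp, hp2, hinj, hprod⟩ :=
    exists_odd_prime_family_of_squarefree hN (Nat.odd_iff.mpr (by omega))
  have hodd : ∀ i, Odd (p i) := fun i => (hp i).odd_of_ne_two (hp2 i)
  subst hprod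
  exact card_selmerGroup_two_eq_eight_of_odd_genusSum_five p hp hodd hinj h8 hor

end SelmerEight

end Literature.NumberTheory.EllipticCurves.Smith2016
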